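import Summits.CriticalPhenomena.PercolationContinuityZ3.Theorems.PercNearOneGluingNoHeavyLowerTailConditionedChampionExchange
import HarnessLib

/-!
# `NoHeavyLowerTail` (stmt-CriticalPhenomena-4575) — SET CHAMPIONSHIP (every set) and the SET CONDITIONED EXCHANGE

Support file (lemma factory #8 `prim-lf-8`, gen 7; `--supports stmt-CriticalPhenomena-4575`).  No definitions, no named facts,
no sorries.  `μ = prodBernoulli w`, relays `A`, level `j`, `R_v = {|π(v)| ≤ j}` (light), `S(v) = μ(R_v)`; `c ∈ A`, `Q` a finite set of
relays with `S(x) ≤ S(c)` for every `x ∈ Q` ("`c` beats `Q`"; `c` need not be a champion); `D = {c ↮ Q} = ⋂_{x∈Q} {c ↮ x}`.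

* `SetChampionship.single_off` — for `x ∈ Q`:  `μ(D ∩ R_x) ≤ μ(D ∩ R_c)`: championship of `c` over `x` SURVIVES conditioning on
  `c` being cut from any further relays.  One line from the conditioned exchange `ConditionedChampionExchange.exchange_typePlus` with the
  type-`(+)` event `E = {c ↮ Q ∖ x}` (decreasing in the cluster of `c`).  Seat screens: 0 / 74 000 (prim-lf-8 CANDIDATES v8 B8-7).
* `SetChampionship.setChampionship` — **set championship, every `|Q|`**:  `μ(D ∩ ⋂_{x∈Q} R_x) ≤ μ(D ∩ R_c)` (immediate from `single_off`;
  the pair case `…ConditionedChampionExchangeSets.setChampionship_pair` had a longer proof).  0 / 24 000 in the screens before the proof.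
* `SetChampionship.exchange_typePlus_finset` — for every event `E` of type `(+)` for `(C_Q, C_{{c}})`:  `μ(E ∩ ⋂_{x∈Q} R_x) ≤ μ(E ∩ R_c)`
  (BHK 2006 two-set exchange given `D` + set championship);
* `setAttachedExchange` — `E = {π(o) ⊇ Q} = ⋂_{x∈Q} {o ↔ x}`:  `μ(π(o) ⊇ Q, Q light) ≤ μ(π(o) ⊇ Q, c light)`, the exchange for an observer whose
  pocket contains the whole set `Q` (for `|Q| = 1` this is `conditionedChampionExchange`).
These are the `Z = Q` instances of the restricted-attachment exchange REX (`…RestrictedAttachmentExchange.lean`); with them the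
exclusion-free statement REX(Q) is reduced to its `{c ↮ Q}`-part comparison of the observer's lightness with `max_{x∈Q} μ(R_x | c ↮ Q)`
(CANDIDATES v8 B8-7: `OBSMAX`, 0 violations).
-/

noncomputable section

namespace Summit.CriticalPhenomena.PercolationContinuityZ3.Theorems

open MeasureTheory Set Literature.Probability.LatticeModels Literature.Probability.Percolation
open scoped Classical BigOperators

variable {n : ℕ}

namespace SetChampionship

open ConditionedChampionExchange

/-- `{c ↮ Y}` (for a finite set `Y`) is of type `(+)` for `(C_{{x}}, C_{{c}})`: it only grows when the cluster of `c` shrinks. [folklore] -/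
theorem cut_typePlus (Y : Finset (Fin n)) (x c : Fin n) ⦃ω ω' : BondConfig (Fin n)⦄
    (hs : (⋃ s ∈ ({x} : Set (Fin n)), openEdgeCluster ω s) ⊆ (⋃ s ∈ ({x} : Set (Fin n)), openEdgeCluster ω' s))
    (ht : (⋃ t ∈ ({c} : Set (Fin n)), openEdgeCluster ω' t) ⊆ (⋃ t ∈ ({c} : Set (Fin n)), openEdgeCluster ω t))
    (h : ω ∈ {ω : BondConfig (Fin n) | ∀ y ∈ Y, ω ∉ (openConn c y : Set (BondConfig (Fin n)))}) :
    ω' ∈ {ω : BondConfig (Fin n) | ∀ y ∈ Y, ω ∉ (openConn c y : Set (BondConfig (Fin n)))} := by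
  intro y hy
  exact TwoSetExchange.typePlus_not_openConn_of_mem ({x} : Set (Fin n)) ({c} : Set (Fin n)) (mem_singleton c) y hs ht
    (h y hy)

/-- **Championship survives cutting the champion from further relays.**  If `x ∈ Q` and `S(x) ≤ S(c)` then
`μ({c ↮ Q} ∩ R_x) ≤ μ({c ↮ Q} ∩ R_c)`. [this work] -/
theorem single_off (w : Sym2 (Fin n) → unitInterval) (A Q : Finset (Fin n)) (x c : Fin n) (j : ℕ) (hx : x ∈ Q)
    (hS : (prodBernoulli w).real {ω : BondConfig (Fin n) | (A.filter fun a => ω ∈ openConn x a).card ≤ j} ≤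
      (prodBernoulli w).real {ω : BondConfig (Fin n) | (A.filter fun a => ω ∈ openConn c a).card ≤ j}) :
    (prodBernoulli w).real ({ω : BondConfig (Fin n) | ∀ y ∈ Q, ω ∉ (openConn c y : Set (BondConfig (Fin n)))} ∩
        {ω | (A.filter fun a => ω ∈ openConn x a).card ≤ j}) ≤
      (prodBernoulli w).real ({ω : BondConfig (Fin n) | ∀ y ∈ Q, ω ∉ (openConn c y : Set (BondConfig (Fin n)))} ∩
        {ω | (A.filter fun a => ω ∈ openConn c a).card ≤ j}) := by
  set μ := prodBernoulli w with hμ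
  set E : Set (BondConfig (Fin n)) := {ω | ∀ y ∈ Q.erase x, ω ∉ (openConn c y : Set (BondConfig (Fin n)))} with hE
  set D : Set (BondConfig (Fin n)) := {ω | ∀ y ∈ Q, ω ∉ (openConn c y : Set (BondConfig (Fin n)))} with hD
  set K : Set (BondConfig (Fin n)) := (openConn x c : Set (BondConfig (Fin n))) with hK
  set Lx : Set (BondConfig (Fin n)) := {ω | (A.filter fun a => ω ∈ openConn x a).card ≤ j} with hLx
  set Lc : Set (BondConfig (Fin n)) := {ω | (A.filter fun a => ω ∈ openConn c a).card ≤ j} with hLc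
  have hmeas : ∀ s : Set (BondConfig (Fin n)), MeasurableSet s := fun _ => MeasurableSet.of_discrete
  have key := exchange_typePlus w A x c j (E := E) (cut_typePlus (Q.erase x) x c) hS
  change μ.real (E ∩ Lx) ≤ μ.real (E ∩ Lc) at key
  -- `D = E ∩ Kᶜ`
  have hDE : D = E ∩ Kᶜ := by
    ext ω
    simp only [hD, hE, hK, mem_setOf_eq, mem_inter_iff, mem_compl_iff]
    constructor
    · intro h
      refine ⟨fun y hy => h y (Finset.mem_of_mem_erase hy), ?_⟩
      rw [KNPreFKG.openConn_symm x c]; exact h x hx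
    · rintro ⟨h, hk⟩ y hy
      by_cases hyx : y = x
      · subst hyx; rw [KNPreFKG.openConn_symm c y]; exact hk
      · exact h y (Finset.mem_erase.2 ⟨hyx, hy⟩)
  have split : ∀ F : Set (BondConfig (Fin n)), μ.real F = μ.real (F ∩ K) + μ.real (F ∩ Kᶜ) := by
    intro F
    rw [← Set.sdiff_eq]
    exact (measureReal_inter_add_sdiff (μ := μ) (s := F) (t := K) (hmeas _)).symm
  have hKeq : E ∩ Lx ∩ K = E ∩ Lc ∩ K := by
    ext ω
    simp only [mem_inter_iff, hLx, hLc, mem_setOf_eq]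
    constructor
    · rintro ⟨⟨he, hl⟩, hk⟩; exact ⟨⟨he, by rw [← filter_eq_of_openConn A hk]; exact hl⟩, hk⟩
    · rintro ⟨⟨he, hl⟩, hk⟩; exact ⟨⟨he, by rw [filter_eq_of_openConn A hk]; exact hl⟩, hk⟩
  have e1 := split (E ∩ Lx)
  have e2 := split (E ∩ Lc)
  rw [hDE]
  have e3 : E ∩ Kᶜ ∩ Lx = E ∩ Lx ∩ Kᶜ := by rw [inter_assoc, inter_comm Kᶜ, ← inter_assoc]
  have e4 : E ∩ Kᶜ ∩ Lc = E ∩ Lc ∩ Kᶜ := by rw [inter_assoc, inter_comm Kᶜ, ← inter_assoc]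
  rw [e3, e4]
  linarith [hKeq ▸ e1]

/-- **Set championship (every finite set).**  If `Q` is nonempty and `S(x) ≤ S(c)` for every `x ∈ Q`, then
`μ({c ↮ Q} ∩ ⋂_{x∈Q} R_x) ≤ μ({c ↮ Q} ∩ R_c)`. [this work] -/
theorem setChampionship (w : Sym2 (Fin n) → unitInterval) (A Q : Finset (Fin n)) (c : Fin n) (j : ℕ) (hQ : Q.Nonempty)
    (hS : ∀ x ∈ Q, (prodBernoulli w).real {ω : BondConfig (Fin n) | (A.filter fun a => ω ∈ openConn x a).card ≤ j} ≤
      (prodBernoulli w).real {ω : BondConfig (Fin n) | (A.filter fun a => ω ∈ openConn c a).card ≤ j}) :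
    (prodBernoulli w).real ({ω : BondConfig (Fin n) | ∀ y ∈ Q, ω ∉ (openConn c y : Set (BondConfig (Fin n)))} ∩
        {ω | ∀ x ∈ Q, (A.filter fun a => ω ∈ openConn x a).card ≤ j}) ≤
      (prodBernoulli w).real ({ω : BondConfig (Fin n) | ∀ y ∈ Q, ω ∉ (openConn c y : Set (BondConfig (Fin n)))} ∩
        {ω | (A.filter fun a => ω ∈ openConn c a).card ≤ j}) := by
  obtain ⟨x, hx⟩ := hQ
  have hsub : ({ω : BondConfig (Fin n) | ∀ y ∈ Q, ω ∉ (openConn c y : Set (BondConfig (Fin n)))} ∩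
        {ω | ∀ x ∈ Q, (A.filter fun a => ω ∈ openConn x a).card ≤ j}) ⊆
      ({ω : BondConfig (Fin n) | ∀ y ∈ Q, ω ∉ (openConn c y : Set (BondConfig (Fin n)))} ∩
        {ω | (A.filter fun a => ω ∈ openConn x a).card ≤ j}) := fun ω hω => ⟨hω.1, hω.2 x hx⟩
  exact le_trans (measureReal_mono hsub (measure_ne_top _ _)) (single_off w A Q x c j hx (hS x hx))

/-- The two-set separation event of `↑Q` and `{c}` is `{c ↮ Q}`. [folklore] -/
theorem sep_finset_eq (Q : Finset (Fin n)) (c : Fin n) :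
    {ω : BondConfig (Fin n) | ∀ s ∈ (↑Q : Set (Fin n)), ∀ t ∈ ({c} : Set (Fin n)), ¬ (openGraph ω).Reachable s t} =
      {ω : BondConfig (Fin n) | ∀ y ∈ Q, ω ∉ (openConn c y : Set (BondConfig (Fin n)))} := by
  ext ω
  simp only [mem_setOf_eq, Finset.mem_coe, mem_singleton_iff, forall_eq]
  refine forall₂_congr fun y _ => ?_
  rw [KNPreFKG.openConn_symm c y]
  rfl

/-- **Positive correlation of two type-`(+)` events given `{c ↮ Q}`.**
[cite: VandenbergHaggstromKahn2005, Thm. 2.1 (p. 9) at q = 1 — corollary] -/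
theorem posCorr_typePlus_finset (w : Sym2 (Fin n) → unitInterval) (Q : Finset (Fin n)) (c : Fin n)
    {E₁ E₂ : Set (BondConfig (Fin n))}
    (hE₁ : ∀ ⦃ω ω' : BondConfig (Fin n)⦄,
      (⋃ s ∈ (↑Q : Set (Fin n)), openEdgeCluster ω s) ⊆ (⋃ s ∈ (↑Q : Set (Fin n)), openEdgeCluster ω' s) →
      (⋃ t ∈ ({c} : Set (Fin n)), openEdgeCluster ω' t) ⊆ (⋃ t ∈ ({c} : Set (Fin n)), openEdgeCluster ω t) →
      ω ∈ E₁ → ω' ∈ E₁)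
    (hE₂ : ∀ ⦃ω ω' : BondConfig (Fin n)⦄,
      (⋃ s ∈ (↑Q : Set (Fin n)), openEdgeCluster ω s) ⊆ (⋃ s ∈ (↑Q : Set (Fin n)), openEdgeCluster ω' s) →
      (⋃ t ∈ ({c} : Set (Fin n)), openEdgeCluster ω' t) ⊆ (⋃ t ∈ ({c} : Set (Fin n)), openEdgeCluster ω t) →
      ω ∈ E₂ → ω' ∈ E₂) :
    (prodBernoulli w).real ({ω : BondConfig (Fin n) | ∀ y ∈ Q, ω ∉ (openConn c y : Set (BondConfig (Fin n)))} ∩ E₁) *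
        (prodBernoulli w).real ({ω : BondConfig (Fin n) | ∀ y ∈ Q, ω ∉ (openConn c y : Set (BondConfig (Fin n)))} ∩ E₂) ≤
      (prodBernoulli w).real ({ω : BondConfig (Fin n) | ∀ y ∈ Q, ω ∉ (openConn c y : Set (BondConfig (Fin n)))} ∩ (E₁ ∩ E₂)) *
        (prodBernoulli w).real {ω : BondConfig (Fin n) | ∀ y ∈ Q, ω ∉ (openConn c y : Set (BondConfig (Fin n)))} := by
  have key := setTwoClusterExchange w (↑Q : Set (Fin n)) ({c} : Set (Fin n))
    (A₁ := E₁) (A₂ := E₂) (B₁ := univ) (B₂ := univ) hE₁ hE₂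
    (fun _ _ _ _ _ => mem_univ _) (fun _ _ _ _ _ => mem_univ _)
  rw [sep_finset_eq Q c] at key
  simpa only [inter_univ, univ_inter] using key

/-- **Set conditioned exchange (every finite set).**  If `Q` is nonempty, `S(x) ≤ S(c)` for `x ∈ Q`, and `E` is of type `(+)` for
`(C_Q, C_{{c}})`, then `μ(E ∩ ⋂_{x∈Q} R_x) ≤ μ(E ∩ R_c)`. [this work] -/
theorem exchange_typePlus_finset (w : Sym2 (Fin n) → unitInterval) (A Q : Finset (Fin n)) (c : Fin n) (j : ℕ)
    (hQ : Q.Nonempty) {E : Set (BondConfig (Fin n))}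
    (hE : ∀ ⦃ω ω' : BondConfig (Fin n)⦄,
      (⋃ s ∈ (↑Q : Set (Fin n)), openEdgeCluster ω s) ⊆ (⋃ s ∈ (↑Q : Set (Fin n)), openEdgeCluster ω' s) →
      (⋃ t ∈ ({c} : Set (Fin n)), openEdgeCluster ω' t) ⊆ (⋃ t ∈ ({c} : Set (Fin n)), openEdgeCluster ω t) →
      ω ∈ E → ω' ∈ E)
    (hS : ∀ x ∈ Q, (prodBernoulli w).real {ω : BondConfig (Fin n) | (A.filter fun a => ω ∈ openConn x a).card ≤ j} ≤
      (prodBernoulli w).real {ω : BondConfig (Fin n) | (A.filter fun a => ω ∈ openConn c a).card ≤ j}) :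
    (prodBernoulli w).real (E ∩ {ω : BondConfig (Fin n) | ∀ x ∈ Q, (A.filter fun a => ω ∈ openConn x a).card ≤ j}) ≤
      (prodBernoulli w).real (E ∩ {ω : BondConfig (Fin n) | (A.filter fun a => ω ∈ openConn c a).card ≤ j}) := by
  set μ := prodBernoulli w with hμ
  set D : Set (BondConfig (Fin n)) := {ω | ∀ y ∈ Q, ω ∉ (openConn c y : Set (BondConfig (Fin n)))} with hD
  set LQ : Set (BondConfig (Fin n)) := {ω | ∀ x ∈ Q, (A.filter fun a => ω ∈ openConn x a).card ≤ j} with hLQ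
  set Lc : Set (BondConfig (Fin n)) := {ω | (A.filter fun a => ω ∈ openConn c a).card ≤ j} with hLc
  set HQ : Set (BondConfig (Fin n)) := {ω | ∃ x ∈ Q, j < (A.filter fun a => ω ∈ openConn x a).card} with hHQ
  have hmeas : ∀ s : Set (BondConfig (Fin n)), MeasurableSet s := fun _ => MeasurableSet.of_discrete
  have hnn : ∀ s : Set (BondConfig (Fin n)), 0 ≤ μ.real s := fun _ => measureReal_nonneg
  -- type (+) events
  have hG₁ : ∀ ⦃ω ω' : BondConfig (Fin n)⦄,
      (⋃ s ∈ (↑Q : Set (Fin n)), openEdgeCluster ω s) ⊆ (⋃ s ∈ (↑Q : Set (Fin n)), openEdgeCluster ω' s) →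
      (⋃ t ∈ ({c} : Set (Fin n)), openEdgeCluster ω' t) ⊆ (⋃ t ∈ ({c} : Set (Fin n)), openEdgeCluster ω t) →
      ω ∈ HQ → ω' ∈ HQ := by
    rintro ω ω' hs ht ⟨x, hx, h⟩
    refine ⟨x, hx, lt_of_lt_of_le h (Finset.card_le_card fun a ha => ?_)⟩
    simp only [Finset.mem_filter] at ha ⊢
    exact ⟨ha.1, TwoSetExchange.typePlus_openConn_of_mem (↑Q : Set (Fin n)) ({c} : Set (Fin n))
      (Finset.mem_coe.2 hx) a hs ht ha.2⟩
  have hG₂ : ∀ ⦃ω ω' : BondConfig (Fin n)⦄,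
      (⋃ s ∈ (↑Q : Set (Fin n)), openEdgeCluster ω s) ⊆ (⋃ s ∈ (↑Q : Set (Fin n)), openEdgeCluster ω' s) →
      (⋃ t ∈ ({c} : Set (Fin n)), openEdgeCluster ω' t) ⊆ (⋃ t ∈ ({c} : Set (Fin n)), openEdgeCluster ω t) →
      ω ∈ Lc → ω' ∈ Lc := by
    intro ω ω' hs ht h
    simp only [hLc, mem_setOf_eq] at h ⊢
    refine le_trans (Finset.card_le_card fun a ha => ?_) h
    simp only [Finset.mem_filter] at ha ⊢
    refine ⟨ha.1, ?_⟩
    by_contra hω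
    exact TwoSetExchange.typePlus_not_openConn_of_mem (↑Q : Set (Fin n)) ({c} : Set (Fin n)) (mem_singleton c) a hs ht
      hω ha.2
  have p1 := posCorr_typePlus_finset w Q c hE hG₁
  have p2 := posCorr_typePlus_finset w Q c hE hG₂
  rw [← hD] at p1 p2
  -- set championship on `D`
  have hSC : μ.real (D ∩ LQ) ≤ μ.real (D ∩ Lc) := setChampionship w A Q c j hQ hS
  -- `F = (F ∩ HQ) ⊔ (F ∩ LQ)`
  have hHL : ∀ F : Set (BondConfig (Fin n)), μ.real F = μ.real (F ∩ HQ) + μ.real (F ∩ LQ) := by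
    intro F
    have hc : F ∩ LQ = F \ HQ := by
      ext ω
      simp only [mem_inter_iff, mem_sdiff, hLQ, hHQ, mem_setOf_eq, not_exists, not_and, not_lt]
    rw [hc]
    exact (measureReal_inter_add_sdiff (μ := μ) (s := F) (t := HQ) (hmeas _)).symm
  have hD1 := hHL D
  have hDE := hHL (D ∩ E)
  have main : μ.real D * μ.real (D ∩ E ∩ LQ) ≤ μ.real D * μ.real (D ∩ E ∩ Lc) := by
    have e1 : D ∩ (E ∩ HQ) = D ∩ E ∩ HQ := (inter_assoc _ _ _).symm
    have e2 : D ∩ (E ∩ Lc) = D ∩ E ∩ Lc := (inter_assoc _ _ _).symm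
    rw [e1] at p1
    rw [e2] at p2
    nlinarith [hnn (D ∩ E), hnn (D ∩ HQ), hnn (D ∩ LQ), hnn (D ∩ Lc), hnn D, hnn (D ∩ E ∩ HQ),
      hnn (D ∩ E ∩ LQ), hnn (D ∩ E ∩ Lc)]
  have hDc : μ.real (D ∩ E ∩ LQ) ≤ μ.real (D ∩ E ∩ Lc) := by
    by_cases h0 : μ.real D = 0
    · have hz : μ.real (D ∩ E ∩ LQ) = 0 :=
        le_antisymm (le_trans (measureReal_mono (show D ∩ E ∩ LQ ⊆ D from fun ω hω => hω.1.1)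
          (measure_ne_top μ _)) h0.le) (hnn _)
      rw [hz]; exact hnn _
    · exact le_of_mul_le_mul_left main (lt_of_le_of_ne (hnn _) (Ne.symm h0))
  -- off `D`: `c` is joined to some `y ∈ Q`, and if all of `Q` is light then so is `c`
  have hoff : μ.real ((E ∩ LQ) ∩ Dᶜ) ≤ μ.real ((E ∩ Lc) ∩ Dᶜ) := by
    refine measureReal_mono (fun ω hω => ⟨⟨hω.1.1, ?_⟩, hω.2⟩) (measure_ne_top μ _)
    have hnD : ω ∉ D := hω.2
    simp only [hD, mem_setOf_eq, not_forall, not_not] at hnD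
    obtain ⟨y, hy, hk⟩ := hnD
    show (A.filter fun a => ω ∈ openConn c a).card ≤ j
    rw [filter_eq_of_openConn A hk]
    exact hω.1.2 y hy
  have s1 : μ.real (E ∩ LQ) = μ.real ((E ∩ LQ) ∩ D) + μ.real ((E ∩ LQ) ∩ Dᶜ) := by
    rw [← Set.sdiff_eq]
    exact (measureReal_inter_add_sdiff (μ := μ) (s := E ∩ LQ) (t := D) (hmeas _)).symm
  have s2 : μ.real (E ∩ Lc) = μ.real ((E ∩ Lc) ∩ D) + μ.real ((E ∩ Lc) ∩ Dᶜ) := by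
    rw [← Set.sdiff_eq]
    exact (measureReal_inter_add_sdiff (μ := μ) (s := E ∩ Lc) (t := D) (hmeas _)).symm
  have e3 : (E ∩ LQ) ∩ D = D ∩ E ∩ LQ := by
    ext ω; simp only [mem_inter_iff]; tauto
  have e4 : (E ∩ Lc) ∩ D = D ∩ E ∩ Lc := by
    ext ω; simp only [mem_inter_iff]; tauto
  rw [s1, s2, e3, e4]
  linarith

/-- **Single-relay set exchange on `{c ↮ Q}`.**  If `x ∈ Q`, `S(x) ≤ S(c)` and `E` is of type `(+)` for `(C_Q, C_{{c}})`, then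
`μ({c ↮ Q} ∩ E ∩ R_x) ≤ μ({c ↮ Q} ∩ E ∩ R_c)` — e.g. with `E = {o ↔ Q}`: given that the champion is cut from `Q`, any member of the pocket set is light at most as
often as the champion, jointly with any type-`(+)` event.  (Two-set exchange + `single_off`.)
[this work] -/
theorem exchange_single_off (w : Sym2 (Fin n) → unitInterval) (A Q : Finset (Fin n)) (x c : Fin n) (j : ℕ) (hx : x ∈ Q)
    {E : Set (BondConfig (Fin n))}
    (hE : ∀ ⦃ω ω' : BondConfig (Fin n)⦄,
      (⋃ s ∈ (↑Q : Set (Fin n)), openEdgeCluster ω s) ⊆ (⋃ s ∈ (↑Q : Set (Fin n)), openEdgeCluster ω' s) →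
      (⋃ t ∈ ({c} : Set (Fin n)), openEdgeCluster ω' t) ⊆ (⋃ t ∈ ({c} : Set (Fin n)), openEdgeCluster ω t) →
      ω ∈ E → ω' ∈ E)
    (hS : (prodBernoulli w).real {ω : BondConfig (Fin n) | (A.filter fun a => ω ∈ openConn x a).card ≤ j} ≤
      (prodBernoulli w).real {ω : BondConfig (Fin n) | (A.filter fun a => ω ∈ openConn c a).card ≤ j}) :
    (prodBernoulli w).real ({ω : BondConfig (Fin n) | ∀ y ∈ Q, ω ∉ (openConn c y : Set (BondConfig (Fin n)))} ∩ E ∩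
        {ω | (A.filter fun a => ω ∈ openConn x a).card ≤ j}) ≤
      (prodBernoulli w).real ({ω : BondConfig (Fin n) | ∀ y ∈ Q, ω ∉ (openConn c y : Set (BondConfig (Fin n)))} ∩ E ∩
        {ω | (A.filter fun a => ω ∈ openConn c a).card ≤ j}) := by
  set μ := prodBernoulli w with hμ
  set D : Set (BondConfig (Fin n)) := {ω | ∀ y ∈ Q, ω ∉ (openConn c y : Set (BondConfig (Fin n)))} with hD
  set Lx : Set (BondConfig (Fin n)) := {ω | (A.filter fun a => ω ∈ openConn x a).card ≤ j} with hLx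
  set Lc : Set (BondConfig (Fin n)) := {ω | (A.filter fun a => ω ∈ openConn c a).card ≤ j} with hLc
  set Hx : Set (BondConfig (Fin n)) := {ω | j < (A.filter fun a => ω ∈ openConn x a).card} with hHx
  have hmeas : ∀ s : Set (BondConfig (Fin n)), MeasurableSet s := fun _ => MeasurableSet.of_discrete
  have hnn : ∀ s : Set (BondConfig (Fin n)), 0 ≤ μ.real s := fun _ => measureReal_nonneg
  have hG₂ : ∀ ⦃ω ω' : BondConfig (Fin n)⦄,
      (⋃ s ∈ (↑Q : Set (Fin n)), openEdgeCluster ω s) ⊆ (⋃ s ∈ (↑Q : Set (Fin n)), openEdgeCluster ω' s) →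
      (⋃ t ∈ ({c} : Set (Fin n)), openEdgeCluster ω' t) ⊆ (⋃ t ∈ ({c} : Set (Fin n)), openEdgeCluster ω t) →
      ω ∈ Lc → ω' ∈ Lc := by
    intro ω ω' hs ht h
    simp only [hLc, mem_setOf_eq] at h ⊢
    refine le_trans (Finset.card_le_card fun a ha => ?_) h
    simp only [Finset.mem_filter] at ha ⊢
    refine ⟨ha.1, ?_⟩
    by_contra hω
    exact TwoSetExchange.typePlus_not_openConn_of_mem (↑Q : Set (Fin n)) ({c} : Set (Fin n)) (mem_singleton c) a hs ht
      hω ha.2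
  have hG₁ : ∀ ⦃ω ω' : BondConfig (Fin n)⦄,
      (⋃ s ∈ (↑Q : Set (Fin n)), openEdgeCluster ω s) ⊆ (⋃ s ∈ (↑Q : Set (Fin n)), openEdgeCluster ω' s) →
      (⋃ t ∈ ({c} : Set (Fin n)), openEdgeCluster ω' t) ⊆ (⋃ t ∈ ({c} : Set (Fin n)), openEdgeCluster ω t) →
      ω ∈ Hx → ω' ∈ Hx := by
    intro ω ω' hs ht h
    simp only [hHx, mem_setOf_eq] at h ⊢
    refine lt_of_lt_of_le h (Finset.card_le_card fun a ha => ?_)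
    simp only [Finset.mem_filter] at ha ⊢
    exact ⟨ha.1, TwoSetExchange.typePlus_openConn_of_mem (↑Q : Set (Fin n)) ({c} : Set (Fin n)) (Finset.mem_coe.2 hx) a hs ht
      ha.2⟩
  have p1 := posCorr_typePlus_finset w Q c hE hG₁
  have p2 := posCorr_typePlus_finset w Q c hE hG₂
  rw [← hD] at p1 p2
  have hSC : μ.real (D ∩ Lx) ≤ μ.real (D ∩ Lc) := single_off w A Q x c j hx hS
  have hHL : ∀ F : Set (BondConfig (Fin n)), μ.real F = μ.real (F ∩ Hx) + μ.real (F ∩ Lx) := by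
    intro F
    have hc : F ∩ Lx = F \ Hx := by
      ext ω; simp only [mem_inter_iff, mem_sdiff, hLx, hHx, mem_setOf_eq, not_lt]
    rw [hc]
    exact (measureReal_inter_add_sdiff (μ := μ) (s := F) (t := Hx) (hmeas _)).symm
  have hD1 := hHL D
  have hDE := hHL (D ∩ E)
  have main : μ.real D * μ.real (D ∩ E ∩ Lx) ≤ μ.real D * μ.real (D ∩ E ∩ Lc) := by
    have e1 : D ∩ (E ∩ Hx) = D ∩ E ∩ Hx := (inter_assoc _ _ _).symm
    have e2 : D ∩ (E ∩ Lc) = D ∩ E ∩ Lc := (inter_assoc _ _ _).symm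
    rw [e1] at p1
    rw [e2] at p2
    nlinarith [hnn (D ∩ E), hnn (D ∩ Hx), hnn (D ∩ Lx), hnn (D ∩ Lc), hnn D, hnn (D ∩ E ∩ Hx),
      hnn (D ∩ E ∩ Lx), hnn (D ∩ E ∩ Lc)]
  by_cases h0 : μ.real D = 0
  · have hz : μ.real (D ∩ E ∩ Lx) = 0 :=
      le_antisymm (le_trans (measureReal_mono (show D ∩ E ∩ Lx ⊆ D from fun ω hω => hω.1.1)
        (measure_ne_top μ _)) h0.le) (hnn _)
    rw [hz]; exact hnn _
  · exact le_of_mul_le_mul_left main (lt_of_le_of_ne (hnn _) (Ne.symm h0))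

end SetChampionship

open SetChampionship

/-- **Set-attached exchange.**  If `Q` is nonempty and `c` beats `Q`, then for every vertex `o`:
`μ((⋂_{x∈Q} {o↔x}) ∩ ⋂_{x∈Q} R_x) ≤ μ((⋂_{x∈Q} {o↔x}) ∩ R_c)` — an observer whose pocket contains all of `Q` still sees `c` at least
as light as its own pocket. [this work] -/
theorem setAttachedExchange (w : Sym2 (Fin n) → unitInterval) (A Q : Finset (Fin n)) (o c : Fin n) (j : ℕ) (hQ : Q.Nonempty)
    (hS : ∀ x ∈ Q, (prodBernoulli w).real {ω : BondConfig (Fin n) | (A.filter fun a => ω ∈ openConn x a).card ≤ j} ≤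
      (prodBernoulli w).real {ω : BondConfig (Fin n) | (A.filter fun a => ω ∈ openConn c a).card ≤ j}) :
    (prodBernoulli w).real ({ω : BondConfig (Fin n) | ∀ x ∈ Q, ω ∈ (openConn o x : Set (BondConfig (Fin n)))} ∩
        {ω | ∀ x ∈ Q, (A.filter fun a => ω ∈ openConn x a).card ≤ j}) ≤
      (prodBernoulli w).real ({ω : BondConfig (Fin n) | ∀ x ∈ Q, ω ∈ (openConn o x : Set (BondConfig (Fin n)))} ∩
        {ω | (A.filter fun a => ω ∈ openConn c a).card ≤ j}) := by
  have hE : ∀ ⦃ω ω' : BondConfig (Fin n)⦄,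
      (⋃ s ∈ (↑Q : Set (Fin n)), openEdgeCluster ω s) ⊆ (⋃ s ∈ (↑Q : Set (Fin n)), openEdgeCluster ω' s) →
      (⋃ t ∈ ({c} : Set (Fin n)), openEdgeCluster ω' t) ⊆ (⋃ t ∈ ({c} : Set (Fin n)), openEdgeCluster ω t) →
      ω ∈ {ω : BondConfig (Fin n) | ∀ x ∈ Q, ω ∈ (openConn o x : Set (BondConfig (Fin n)))} →
      ω' ∈ {ω : BondConfig (Fin n) | ∀ x ∈ Q, ω ∈ (openConn o x : Set (BondConfig (Fin n)))} := by
    intro ω ω' hs ht h x hx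
    have h' := h x hx
    rw [KNPreFKG.openConn_symm o x] at h' ⊢
    exact TwoSetExchange.typePlus_openConn_of_mem _ _ (Finset.mem_coe.2 hx) o hs ht h'
  exact exchange_typePlus_finset w A Q c j hQ hE hS

end Summit.CriticalPhenomena.PercolationContinuityZ3.Theorems

end
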